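import Mathlib
import HarnessLib
import HarnessLib.Audit
import Summits.Langlands.Statement

/-!
Route: SqrtFiveQuarticCovers

DORMANT since 2026-09-05T02:35:22Z (reconciler: no traction for 5 d (last activity item-evidence-added at 2026-08-31T01:53:49Z); parked, not closed — `ledger route dormant route-Langlands-SqrtFiveQuarticCovers --off` to reactivate) — unstaffed, not closed; items shared with open routes are served there. `ledger route dormant <id> --off` reactivates.

# Route SqrtFiveQuarticCovers — det-refined level-5 double covers make the √5-quartic residue of
elliptic-curve modularity a finite certificate

It suffices to show X (decl `Target`): every elliptic curve over every TOTALLY REAL QUARTIC number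
field K is modular in the tree's sense
(`IsModularEllipticCurve K E`: geometric CM, or a weight-zero cuspidal π of GL₂(𝔸_K) with
T_w-eigenvalue a_w(E) at cofinitely many w) —
the sector (B) of the summit for n = 2, F totally real of degree 4, ρ = V_ℓ(E). Box2022 proved X for
K ∌ √5; for K ∋ √5 his §7.1 asks for
16 coarse modular curves over ℚ(√5) plus a missing lifting theorem for "ℚ(√5)-curves". X here =
Box's theorem (support `BoxQuartic`) ∧
the √5-half, and the √5-half is reduced to ONE finite certificate (crux `RefinedLocusModular`: the
ℚ(√5)-quadratic points of eight
determinant-refined double covers) by the reduction crux `ReductionToRefinedLocus` and Box's own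
four b5-curves (`BoxBorelFive`).
X → Langlands is the support item `SectorComplement` (the honest name for the rest of the summit).
Lean: `∀ (K : Type) [Field K] [NumberField K], NumberField.IsTotallyReal K → Module.finrank ℚ K = 4
→ ∀ E : WeierstrassCurve (NumberField.RingOfIntegers K), E.Δ ≠ 0 →
Literature.NumberTheory.Automorphic.IsModularEllipticCurve K E`
(Rev 5, cone repair: in the filed items `IsModularEllipticCurve` and
`WeierstrassCurve.IsTorsionGaloisRep` are WRITTEN OUT by their definitions — `Iff.rfl`-equivalent to
the rev-4 items — so that the route file imports only `Summits.Langlands.Statement`; none of the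
BCDT / Shimura-construction / Hasse–Weil / base-change / Caraiani–Newton named facts that rode in on
the two definition imports is used by any item or by `closes`.)

## Assembly
Pure logic, sorry-free, certified (authority native): `closes (h₂ : RefinedLocusModular) (h₃ :
ReductionToRefinedLocus) (h₄ : BoxBorelFive) (hB : BoxQuartic) (hC : SectorComplement) : Langlands
:= hC target`, with `target : Target` derived inside: given K totally real of degree 4 and E with Δ
≠ 0, if ¬∃ r, r² = 5 apply hB; else argue by contradiction — for E not modular h₃ gives the
3-clause, the 7-clause and the 5-dichotomy Borel ∨ (H8 ∨ H12) (the certified census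
`GroupCensusFive` is the documentation behind that dichotomy); Borel ⇒ h₄, H8/H12 ⇒ h₂, each
concluding that E is modular — contradiction.

Rationale: WHY THIS LINE. MECHANISM. For K totally real with √5 ∈ K the mod-5 representation of E/K has det
ρ̄_{E,5} = ε̄₅ ∈ {±1}, and FLS Theorem 3 (Kisin/Breuil–Diamond
lifting + Langlands–Tunnell + 3–5 switch; FreitasLeHungSiksek2015 Thm 3, with their √5-repair of the
p = 5 Taylor–Wiles hypothesis, §(modlift))
proves E modular unless ρ̄_{E,5}(G_{K(ζ₅)}) is absolutely reducible; an exhaustive census of GL₂(𝔽₅)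
(FLS Remark (iii) after Cor. 2.1; RE-RUN
and certified here, folder compute/census_gl2f5.py: 243 subgroups of {det = ±1}, 45 bad, orders 6 ⊂
12 and 8) shows the bad non-Borel
images are conjugate into TWO explicit dihedral groups H8 = ⟨diag(2,3), antidiag(1,1)⟩ ≅ D₄ ⊂
C_s⁺(5) and H12 = ⟨(3 1;3 3), diag(1,4)⟩ ≅ D₆
⊂ C_ns⁺(5), index 2 in the det-±1 parts of the Cartan normalisers; the corresponding moduli curves
X(u3, v5, w7), u ∈ {b, s}, v ∈ {H8, H12},
w ∈ {b, e7} (3-part Rubin/FLS Prop. 1.1(a); 7-part Kalyanswamy2018 + FLS e7, Box2022 Thm 1.3(iii),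
valid because K ∩ ℚ(ζ₇) = ℚ for quartic
K) are DOUBLE COVERS, defined over ℚ(√5), of Box's coarse curves X(u3, s5/ns5, w7). Two consequences
nobody drew: (i) the generic members
of Box's "infinite families of ℚ(√5)-curves of unknown modularity" (pull-backs of X(b3,ns5)/w₃ ≅ ℙ¹
and of the positive-rank elliptic curve
X(ns5,b7)/w₇ over ℚ(√5)) have 5-image C_ns⁺(5) ∩ {det = ±1} (order 24, SL₂-part Dic₃, absolutely
irreducible) and are therefore ALREADY
MODULAR by FLS Thm 3 — no new lifting theorem for ℚ(√5)-curves is needed; (ii) every refined curve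
has PSL₂(ℤ)-index ≥ 4·20·8 = 640, so
Abramovich's bound gives gonality ≥ 5.6 > 4 and Harris–Silverman makes its set of quadratic points
over ℚ(√5) FINITE: the √5-residue
(known to be finite only ineffectively and over F(ζ₁₀₅), Hung2013 Thm 5.5; "all but finitely many
quartic fields", IshitsukaItoYoshikawa2021
§1) becomes an explicit, finite determination of quadratic points over ℚ(√5) on eight curves,
attackable with Box's quotient-curve models
(Box2021), relative symmetric Chabauty (BoxGajovicGoodman2021) and the FLS/Box fibre-product
Mordell–Weil sieve, followed by individual
certificates (CM, ℚ-curves, base change, or Faltings–Serre against a computed Hilbert newform) for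
the finitely many exceptional j.
Imported areas: explicit arithmetic geometry of modular curves (gonality, symmetric-power Chabauty
over a real quadratic base, Mordell–Weil
sieves) and finite group theory (the 𝔽₅ census); the automorphic input is the printed lifting
theorems only. Versus the 45 open routes: none
treats elliptic curves over totally real fields, none uses rational points on modular curves or a
subgroup census as its lever; the
negatives index (one K3 typing kill) is untouched.

RANKED CRUXES. #0 Target (target) — every elliptic curve (integral Weierstrass model with Δ ≠ 0)
over every totally real quartic number field is modular (`IsModularEllipticCurve`). (why it might
fail: it is Box's theorem plus the √5-half below; it fails only if some elliptic curve over a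
quartic field containing √5 is genuinely non-modular (contradicting Langlands) — the risk is
unprovability, not falsity.) [Box2022, FreitasLeHungSiksek2015, Hung2013, IshitsukaItoYoshikawa2021]
#2 RefinedLocusModular (crux) — [computational certificate] for K totally real quartic with √5 ∈ K
and E/K elliptic whose mod-3 image is Borel or inside C_s⁺(3), whose mod-5 image is inside H8 or H12
(up to conjugacy, i.e. for some framing of E[5]) and whose mod-7 image is Borel or inside G(e7): E
is modular. Settled by determining the finitely many quadratic points over ℚ(√5) of the eight
refined curves X(u3, v5, w7), u ∈ {b,s}, v ∈ {H8,H12}, w ∈ {b,e7} (non-hyperelliptic,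
non-bielliptic: index ≥ 640), and certifying each non-cuspidal, non-CM point modular (ℚ-curve / base
change / Faltings–Serre against a computed Hilbert newform). [difficulty: XL] (why it might fail: a
refined curve (genus ≈ 50–630) may admit no quotient tree on which symmetric Chabauty over ℚ(√5)
closes (Jacobian factors of positive rank over ℚ(√5), rank ≥ genus on every small quotient), leaving
the finite set provably finite but not computable.) [Box2022, BoxGajovicGoodman2021, Box2021,
FreitasLeHungSiksek2015, DerickxNajmanSiksek2020, arXiv:1310.7088]
#3 ReductionToRefinedLocus (crux) — for K totally real quartic with √5 ∈ K and E/K elliptic NOT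
modular: ρ̄_{E,3} is Borel or lands in C_s⁺(3) = ⟨diag(1,2), antidiag(1,1)⟩; ρ̄_{E,7} is Borel or
lands in G(e7) = ⟨(0 5;3 0), (5 0;3 2)⟩; and ρ̄_{E,5} is Borel or its image lies in a subgroup G ≤
GL₂(𝔽₅) with det(G) ⊆ {±1}, an element of trace 0 and determinant −1, no common 𝔽₅-eigenline, and
determinant-1 part not spanning M₂(𝔽₅) (each for some framing) — exactly the hypotheses of the
certified census `GroupCensusFive`, which `closes` then applies. Chain: FLS Thms 3–4 (lifting at p =
3, 5, 7 incl. the √5-repair at 5) ⇒ each ρ̄_{E,p}(G_{K(ζ_p)}) = ρ̄(G_K) ∩ SL₂ absolutely reducible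
(⇒ the span condition, Burnside); det ρ̄_{E,5} = ε̄₅ ∈ {±1} because √5 ∈ K; complex conjugation
gives the odd element; FLS Prop. 3.1/Lemma 3.2; p = 3: Rubin/FLS Prop. 1.1(a) (K ∩ ℚ(ζ₃) = ℚ); p =
7: Kalyanswamy2018 kills the split-Cartan case d7 and FLS refine ns7 to e7 (K ∩ ℚ(ζ₇) = ℚ for [K:ℚ]
= 4). [difficulty: M] (why it might fail: the printed 7-adic inputs (Kalyanswamy's d7 elimination,
the FLS e7 refinement) or the ordinary/pot-BT case split at v ∣ p for additive reduction may carry a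
hypothesis that fails for some quartic K ∋ √5 with 7 or 3 ramified; then w7 must be widened to {b7,
d7, e7} (12 curves).) [FreitasLeHungSiksek2015, Kalyanswamy2018, Thorne2016, KisinModuli2009,
Box2022]
#4 BoxBorelFive (crux) — for K totally real quartic with √5 ∈ K and E/K elliptic with mod-3 image
Borel or in C_s⁺(3), mod-5 image BOREL, mod-7 image Borel or in G(e7): E is modular — because E then
gives a quartic point on X₀(105), X(s3,b5,b7), X(b3,b5,e7) or X(s3,b5,e7), and Box2022 §§3–6
determined ALL quartic points of these four curves (the only ones over a field containing √5 are the
CM points of discriminant −20 over ℚ(√5, i), his Prop. (quadptprop)(v) and Remark 4.7), every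
non-cuspidal one being CM or a ℚ-curve or of rational j. [difficulty: M] (why it might fail: Box's
sieve might have used the standing hypothesis √5 ∉ K to discard quartic points over fields
containing √5 (it should enter only through his Thm 1.2); if so those points must be re-sieved over
ℚ(√5).) [Box2022, Box2021, BoxGajovicGoodman2021]
#9 BoxQuartic (support) — Box's theorem: every elliptic curve over a totally real quartic field NOT
containing √5 is modular (a printed theorem; to be vendored as a named fact and consumed as a
hypothesis). [difficulty: provable-now] [Box2022]
#9 GroupCensusFive (support) — [finite certificate, decidable] every subgroup G ≤ GL₂(𝔽₅) with
det(G) ⊆ {±1}, containing an element of trace 0 and determinant −1, acting irreducibly on 𝔽₅², whose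
determinant-1 part does not span M₂(𝔽₅) (= is absolutely reducible, Burnside), is conjugate into H8
or into H12. USED BY `closes` (it turns the Cartan data of ReductionToRefinedLocus into the H8/H12
framing of RefinedLocusModular). Verified by exhaustive enumeration (compute/census_gl2f5.py: 243
subgroups of {det = ±1}, 45 bad of orders 6, 8, 12, all conjugate into H8/H12); in-kernel target:
`decide`/`native_decide` over `GL (Fin 2) (ZMod 5)`, else a kit certificate listing the conjugators.
[difficulty: provable-now] [FreitasLeHungSiksek2015]
#9 ConjFraming (support) — change of framing: if ρ̄ is the mod-5 representation of E in some basis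
of E[5], so is its conjugate x ρ̄ x⁻¹ by any x ∈ GL₂(𝔽₅) (compose the basis isomorphism with x).
Used by `closes`; provable now from `WeierstrassCurve.IsTorsionGaloisRep` and
`FramedRep.conj_apply`. [difficulty: provable-now] [SilvermanCSS1997]
#9 SectorComplement (support) — the honest name for the rest of the summit: X (all quartic elliptic
curves modular) → Langlands. Trivially implied by `Langlands`; it contains direction (A), every (n,
F) other than (2, totally real quartic, V_ℓ E), local–global compatibility at every place and the
data 𝓡. Refuters/graders: judge the route on RefinedLocusModular / ReductionToRefinedLocus /
BoxBorelFive, never on this item; never staffed from this route. [difficulty: open-problem]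
[BuzzardGeeLMS2014, Box2022]

TWO-LAYER PLAN. Once the first kit job fixes the quotient trees: RefinedLocusModular ⇐
RefinedLocusH12 (the four H12-curves, index 640–5040) → RefinedLocusH8
(the four H8-curves, index 960–7560) → RefinedLocusModular (k = 2), or by level at 7 (b7-curves
first, then e7). ReductionToRefinedLocus ⇐
FiveStep (FLS Thm 3 + census) → ThreeSevenStep (Rubin, Kalyanswamy, FLS e7) →
ReductionToRefinedLocus. Nothing filed now.

KILL CRITERIA. RefinedLocusModular is refuted only by a NON-MODULAR elliptic curve over a quartic
field containing √5 — that is ¬Langlands (close the summit's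
question, not just the route). It is ABANDONED (close `exhausted`) if the first two kit jobs show
every refined curve has all small quotients of
Jacobian rank ≥ genus over ℚ(√5) and no fibre-product sieve handle — then the residue is provably
finite (Hung2013) but not presently computable,
and the census + reduction are handed to a theory route (residually dihedral lifting induced from
K(ζ₅)). ReductionToRefinedLocus refuted at 7
⇒ pivot: widen w7 to {b,d,e} (12 curves), same method. A residually-dihedral-from-K(ζ₅) lifting
theorem proved elsewhere (Thorne-type with
[K(ζ₅):K] = 2) moots the H8/H12 half of the route (then only Box's b5-curves remain, already done).

NOT DECOMPOSED YET. The eight curves are not filed one by one (layer-2 children after the quotient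
trees are known); the individual certificates for exceptional
points (Faltings–Serre against Hilbert newforms over specific quartic fields) are not items; the
compute-infra port (modular-curve models for
det-refined level structures over ℚ(√5), Box2021's algorithm outside Magma) is a definition request,
not a crux; quintic fields
(IshitsukaItoYoshikawa2021) are deliberately out of scope.

CHEAPEST FALSIFIER. RUN (folder compute/census_gl2f5.py, 3 s): the 𝔽₅ census is TRUE (45 bad
subgroups, orders 6/8/12, all conjugate into H8 or H12) — had a
bad subgroup escaped H8 ∪ H12 the reduction would be false as typed. RUN (by hand):
index(X(u3,v5,w7)) ∈ [640, 7560] ⇒ gonality > 4 ⇒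
finitely many ℚ(√5)-quadratic points (Abramovich + Harris–Silverman), so no infinite family can
defeat the certificate. NOT RUN (first kit
job, ≈ hours): for X(b3,H12,b7) (index 640, genus ≈ 50) compute the automorphism group generated by
the deck involution, w₃, w₇, the genera
of all quotients, and the analytic ranks over ℚ(√5) (= rank over ℚ of A_f plus rank of A_f ⊗ χ₅) of
the weight-2 newform factors of its
Jacobian; if no quotient of genus g ≤ 8 has rank < 2(g − 1) over ℚ(√5) (Siksek's symmetric-Chabauty
condition for quadratic points over a
quadratic base), the computational line is dead on arrival for that curve.

NUMBERS. Subgroup data (certified): |H8| = 8 (D₄), |H12| = 12 (D₆), H6 ⊂ H12, |C_s⁺(3)| = 8, |G(e7)|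
= 48 (index 2 in C_ns⁺(7)); indices in PSL₂(ℤ):
b3 4, s3 6, H8 30, H12 20, b7 8, e7 42; refined-curve indices 640 (b3,H12,b7) … 7560 (s3,H8,e7),
genera ≈ index/12 ≈ 50 … 630 (coarse
curves: X(b3,ns5) g 2, X(b3,s5) g 3, X(s3,s5) g 4, X₀(105) g 13, X(s3,b5,b7) g 21, X(b3,b5,e7) g 73,
X(s3,b5,e7) g 153; Box2022,
FreitasLeHungSiksek2015). Abramovich: gonality ≥ 7·index/800 ≥ 5.6. Harris–Silverman: genus ≥ 2, not
hyperelliptic/bielliptic ⇒ finitely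
many quadratic points over any number field. Box's √5-points on the b5-curves: j = 632000 ±
282880√5, CM by disc −20 (Box2022 Rem. 4.7).
Items at open: 9 (3 cruxes, 1 target, 4 supports, 1 assembly).

DEFINITION REQUESTS. None for the statements (IsModularEllipticCurve,
WeierstrassCurve.IsTorsionGaloisRep, FramedGaloisRep, NumberField.IsTotallyReal exist).
Compute-infra (to file after open): (1) models over ℚ(√5) of the det-refined modular curves X_H, H ∈
{H8, H12} combined with b3/s3 and
b7/e7 (port of Box2021's quotient-model algorithm to Sage/PARI on the lane); (2) a
symmetric-Chabauty + Mordell–Weil-sieve driver over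
ℚ(√5) (BoxGajovicGoodman2021). Cite facts wanted as hypotheses: Box2022 Thm 1.1 (BoxQuartic), FLS
Thms 3–4, Kalyanswamy2018 Thm 1.

Novelty: Searches (2026-08-16): `lit search --source arxiv "elliptic curves over totally real quartic fields
modular" --year-from 2021` (1: Box);
`lit search --source crossref "modularity elliptic curves quartic fields containing sqrt5"
--year-from 2021` (10, none relevant beyond Box);
`lit citing doi:10.1090/tran/8557` (17 citers read: IshitsukaItoYoshikawa2021 = degree 5
all-but-finitely-many; Zhang 2023, cyclotomic
ℤ_p-extensions; surveys arXiv:2304.09003, arXiv:2401.03099 — none treats √5 ∈ K); `lit search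
--source zbmath "... totally real fields
degree four five ... 2022–"` (0); `lit galaxy search "totally real quartic fields not containing" /
"elliptic curves over totally real quartic"
--star all` (0/0); read in full: Box2022 §1, §3–4, §7 (arXiv:2103.13975), FLS §§1–3, (modlift),
(imagesagain), Remark (iii)
(arXiv:1310.7088), Hung2013 §5 (arXiv:1309.4134), IIY §1 (arXiv:2110.04078), CaraianiNewton2023 §1;
all 45 open Langlands route headers.
Nearest prior art found: Box2022 §7.1 (poses the √5-quartic case as 16 coarse curves
X(u3,{b,s,ns}5,w7) plus a missing lifting theorem for
ℚ(√5)-curves); FreitasLeHungSiksek2015 Remark (iii) after Cor. 2.1 (lists the three det-±1 subgroups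
of orders 6, 8, 12 but declines to use
refined curves); Hung2013 Thm 5.5 (ineffective finiteness over F(ζ₁₀₅) via full torus level and
Faltings).
Delta: use the det-refined subgroups H8/H12 to replace Box's coarse Cartan curves by their double
covers over ℚ(√5): the generic members of
his infinite ℚ(√5)-cu  [refs: 10.1090/tran/8557`, 2304.09003, 2401.03099, 2103.13975, 1310.7088, 1309.4134, 2110.04078, doi:10.1090/tran/8557, IshitsukaItoYoshikawa2021, Box2022, Hung2013, CaraianiNewton2023, FreitasLeHungSiksek2015]

Barriers (technique_class: modular-curve-points, det-refined-level, chabauty-cert): - technique_class: modular-curve-points, det-refined-level, chabauty-cert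
- Literature.Barriers.Langlands.ResiduallyReducibleBarrier: evaded — the small-image (Borel /
dihedral-from-K(ζ₅)) curves are never lifted; they are ENUMERATED as quadratic points on explicit
curves of gonality > 4 and certified individually; lifting is used only where FLS Thms 3–4 print it
(big image at 3, 5 or 7).
- Literature.Barriers.Langlands.SolvableImageBarrier: not in play — residual modularity comes from
Langlands–Tunnell at 3 (soluble GL₂(𝔽₃)) and the 3–5 / 3–7 switches exactly as in FLS; no insoluble
Artin image is base-changed.
- Literature.Barriers.Langlands.TaylorWilesNumericalCoincidence: not in this technique class (n = 2
over a totally real field, where the coincidence holds; the p = 5, √5 ∈ K degeneration of the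
Taylor–Wiles hypothesis is precisely what the census isolates into H8/H12).
- Literature.Barriers.Langlands.PatchingLocalComponentBarrier: not load-bearing — weight-2
potentially Barsotti–Tate / ordinary lifting (Kisin, Breuil–Diamond, as consumed by FLS) is the only
ℓ = p input; no change of component is attempted.
- Literature.Barriers.Langlands.NonRegularWeightBarrier: not in play (parallel weight 2 is regular).
- Literature.Barriers.Langlands.ShimuraVarietyRealizationBarrier: not in play (GL₂ over a totally
real field: Hilbert modular varieties / Shimura curves carry the Galois representations of the
target π).
- Literature.Barriers.Langlands.ModPLanglandsGL2BeyondQpFpBar: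

History (route lifecycle, newest last):
- 2026-08-24T21:56:09Z · DORMANT — reconciler: no traction for 7.1 d (last activity statement-claimed at 2026-08-17T18:51:59Z); parked, not closed — `ledger route dormant route-Langlands-SqrtFive (operator:999:1818842)
- 2026-08-28T14:21:25Z · REACTIVATED — F-L1 GO (director-frontier K-FL1-1; 21-frontier 13:30:07Z); lg-quartmod cell mints 14:30Z (operator:999:2657685)
- 2026-08-28T21:53:07Z · rev 8: informal re-worded for CertS3H12 (planner-lg-quartmod-asm-plan-g0-0)
- 2026-08-28T21:53:47Z · rev 9: informal re-worded for CertH12B7 (planner-lg-quartmod-asm-plan-g0-0)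
- 2026-08-28T21:54:35Z · rev 10: informal re-worded for CertB3H8 (planner-lg-quartmod-asm-plan-g0-0)
- 2026-08-28T21:55:14Z · rev 11: informal re-worded for CertB3E7 (planner-lg-quartmod-asm-plan-g0-0)
- 2026-08-28T21:55:35Z · rev 12: informal re-worded for CertS3H8 (planner-lg-quartmod-asm-plan-g0-0)
- 2026-09-05T02:35:22Z · DORMANT — reconciler: no traction for 5 d (last activity item-evidence-added at 2026-08-31T01:53:49Z); parked, not closed — `ledger route dormant route-Langlands-SqrtFive (operator:999:2640092)

sub-problem: Langlands · status: dormant · opened planner-plan-novel-Langlands-Langlands-e266a39d-d-v2-g11-0 2026-08-16T23:22:53Z · rev 12 · ledger route-Langlands-SqrtFiveQuarticCovers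
GENERATED by the gate from the ledger (D-0016/17). Provers cite these decls: `theorem foo : Summit.Langlands.Langlands.Theses.SqrtFiveQuarticCovers.<Decl> := …` in Summits/Langlands/Langlands/Theorems/<Name>.lean.
-/

namespace Summit.Langlands.Langlands.Theses.SqrtFiveQuarticCovers

open scoped BigOperators Topology Manifold Classical MeasureTheory ProbabilityTheory Matrix InnerProductSpace ComplexConjugate ContinuousMap
open Filter Set Function TopologicalSpace MeasureTheory

attribute [summit_statement] _root_.Langlands

-- earlier Target (stmt-Langlands-17587, replaced 2026-08-16T23:40:01Z -> stmt-Langlands-17832): retired by None — ∀ (K : Type) [Field K] [NumberField K], NumberField.IsTotallyReal K → Module.finrank ℚ K = 4 → ∀ E : WeierstrassCurve (NumberField.RingOfIntegers K), E.Δ ≠ 0 → Literature.NumberTheory.Automorphic.IsModularEllipticCurve K E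
/-- item stmt-Langlands-17832 · target · rank 0 · open · by planner
why it might fail: it is Box's theorem plus the √5-half; it fails only if some elliptic curve over a quartic field containing √5 is genuinely non-modular (contradicting Langlands) — the risk is unprovability, not falsity.
sources: Box2022, FreitasLeHungSiksek2015, Hung2013, IshitsukaItoYoshikawa2021
[target] every elliptic curve (integral Weierstrass model with Δ ≠ 0) over every totally real
quartic number field is modular (`Literature.NumberTheory.Automorphic.IsModularEllipticCurve K E`,
written out by its definition so that the route file imports only the summit Statement's cone:
geometric CM, or a weight-zero cuspidal π of GL₂(𝔸_K) whose T_w-eigenvalue is a_w(E) at cofinitely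
many finite places w). -/
@[route_item "route-Langlands-SqrtFiveQuarticCovers"]
def Target : Prop :=
  ∀ (K : Type) [Field K] [NumberField K], NumberField.IsTotallyReal K → Module.finrank ℚ K = 4 → ∀ E : WeierstrassCurve (NumberField.RingOfIntegers K), E.Δ ≠ 0 → ((E.baseChange K).HasCM ∨ ∃ (hF : Literature.NumberTheory.Automorphic.isCompact_glFiniteIntegralLevel 2 K) (π : Literature.NumberTheory.Automorphic.CuspidalAutomorphicRepData 2 K hF), π.1.HasWeightZero ∧ ∀ᶠ w : IsDedekindDomain.HeightOneSpectrum (NumberField.RingOfIntegers K) in Filter.cofinite, ∃ α : Multiset ℂ, π.1.HasSatakeParamAt w α ∧ ((Real.sqrt w.residueCard : ℝ) : ℂ) * α.sum = (Literature.NumberTheory.Automorphic.frobTraceAt E w : ℂ))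

-- earlier RefinedLocusModular (stmt-Langlands-17588, replaced 2026-08-16T23:40:01Z -> stmt-Langlands-17833): retired by None — ∀ (K : Type) [Field K] [NumberField K], NumberField.IsTotallyReal K → Module.finrank ℚ K = 4 → (∃ r : K, r ^ 2 = 5) → ∀ E : WeierstrassCurve (NumberField.RingOfIntegers K), E.Δ ≠ 0 → (∃ ρ : Literature.NumberTheory.GaloisRepresentations.FramedGaloisRep K (ZMod 3) 2, (E.baseCh
/-- item stmt-Langlands-17833 · crux · rank 2 · SPLIT (gen 1) into CertB3H8, CertH12B7, CertS3H8, CertB3E7, CertS3H12 + glue RefinedLocusModularGlue · direct attempts still welcome (low priority) · by planner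
why it might fail: a refined curve (genus ≈ 50–630) may admit no quotient tree on which symmetric Chabauty over ℚ(√5) closes (Jacobian factors of positive rank over ℚ(√5), rank ≥ genus on every small quotient), leaving the finite set provably finite but not computable.
sources: Box2022, BoxGajovicGoodman2021, Box2021, FreitasLeHungSiksek2015, DerickxNajmanSiksek2020
[crux] [computational certificate] for K totally real quartic with √5 ∈ K and E/K elliptic whose
mod-3 image is Borel or inside C_s⁺(3), whose mod-5 image is inside H8 or H12 (up to conjugacy, i.e.
for some framing of E[5]) and whose mod-7 image is Borel or inside G(e7): E is modular
(`Literature.NumberTheory.Automorphic.IsModularEllipticCurve K E`, written out by its definition so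
that the route file imports only the summit Statement's cone: geometric CM, or a weight-zero
cuspidal π of GL₂(𝔸_K) whose T_w-eigenvalue is a_w(E) at cofinitely many finite places w). Here 'ρ
is the mod-p representation of E in some framing' is `WeierstrassCurve.IsTorsionGaloisRep p ρ`
written out by its definition: a ℤ/p-linear isomorphism e : E[p](K̄) ≃ (ℤ/p)² with e(σ•P) =
ρ(σ)·e(P). Settled by determining the finitely many quadratic points over ℚ(√5) of the eight refined
curves X(u3, v5, w7), u ∈ {b,s}, v ∈ {H8,H12}, w ∈ {b,e7} (non-hyperelliptic, non-bielliptic: index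
≥ 640), and certifying each non-cuspidal, non-CM point modular (ℚ-curve / base change /
Faltings–Serre against a computed Hilbert newform). [difficulty: XL] -/
@[route_item "route-Langlands-SqrtFiveQuarticCovers"]
def RefinedLocusModular : Prop :=
  ∀ (K : Type) [Field K] [NumberField K], NumberField.IsTotallyReal K → Module.finrank ℚ K = 4 → (∃ r : K, r ^ 2 = 5) → ∀ E : WeierstrassCurve (NumberField.RingOfIntegers K), E.Δ ≠ 0 → (∃ ρ : Literature.NumberTheory.GaloisRepresentations.FramedGaloisRep K (ZMod 3) 2, (∃ e : (E.baseChange K).geomTorsion ((3 : ℕ) : ℤ) ≃+ (Fin 2 → ZMod 3), ∀ (σ : Field.absoluteGaloisGroup K) (P : (E.baseChange K).geomTorsion ((3 : ℕ) : ℤ)), e (σ • P) = ((ρ σ : GL (Fin 2) (ZMod 3)) : Matrix (Fin 2) (Fin 2) (ZMod 3)) *ᵥ (e P)) ∧ ((∀ σ : Field.absoluteGaloisGroup K, (((ρ σ : GL (Fin 2) (ZMod 3)) : Matrix (Fin 2) (Fin 2) (ZMod 3)) 1 0 = 0)) ∨ (∀ σ : Field.absoluteGaloisGroup K, (ρ σ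 : GL (Fin 2) (ZMod 3)) ∈ Subgroup.closure ({(⟨!![1, 0; 0, 2], !![1, 0; 0, 2], by decide, by decide⟩ : GL (Fin 2) (ZMod 3)), (⟨!![0, 1; 1, 0], !![0, 1; 1, 0], by decide, by decide⟩ : GL (Fin 2) (ZMod 3))} : Set (GL (Fin 2) (ZMod 3)))))) → (∃ ρ : Literature.NumberTheory.GaloisRepresentations.FramedGaloisRep K (ZMod 5) 2, (∃ e : (E.baseChange K).geomTorsion ((5 : ℕ) : ℤ) ≃+ (Fin 2 → ZMod 5), ∀ (σ : Field.absoluteGaloisGroup K) (P : (E.baseChange K).geomTorsion ((5 : ℕ) : ℤ)), e (σ • P) = ((ρ σ : GL (Fin 2) (ZMod 5)) : Matrix (Fin 2) (Fin 2) (ZMod 5)) *ᵥ (e P)) ∧ ((∀ σ : Field.absoluteGaloisGroup K, (ρ σ : GL (Fin 2) (ZMod 5)) ∈ Subgroup.closure ({(⟨!![2, 0; 0, 3], !![3, 0; 0, 2], by decide, by decide⟩ : GL (Fin 2) (ZMod 5)), (⟨!![0, 1; 1, 0], !![0, 1; 1, 0], by decide, by decide⟩ : GL (Fin 2) (ZMod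 5))} : Set (GL (Fin 2) (ZMod 5)))) ∨ (∀ σ : Field.absoluteGaloisGroup K, (ρ σ : GL (Fin 2) (ZMod 5)) ∈ Subgroup.closure ({(⟨!![3, 1; 3, 3], !![3, 4; 2, 3], by decide, by decide⟩ : GL (Fin 2) (ZMod 5)), (⟨!![1, 0; 0, 4], !![1, 0; 0, 4], by decide, by decide⟩ : GL (Fin 2) (ZMod 5))} : Set (GL (Fin 2) (ZMod 5)))))) → (∃ ρ : Literature.NumberTheory.GaloisRepresentations.FramedGaloisRep K (ZMod 7) 2, (∃ e : (E.baseChange K).geomTorsion ((7 : ℕ) : ℤ) ≃+ (Fin 2 → ZMod 7), ∀ (σ : Field.absoluteGaloisGroup K) (P : (E.baseChange K).geomTorsion ((7 : ℕ) : ℤ)), e (σ • P) = ((ρ σ : GL (Fin 2) (ZMod 7)) : Matrix (Fin 2) (Fin 2) (ZMod 7)) *ᵥ (e P)) ∧ ((∀ σ : Field.absoluteGaloisGroup K, (((ρ σ : GL (Fin 2) (ZMod 7)) : Matrix (Fin 2) (Fin 2) (ZMod 7)) 1 0 = 0)) ∨ (∀ σ : Field.absoluteGaloisGroup K, (ρ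 σ : GL (Fin 2) (ZMod 7)) ∈ Subgroup.closure ({(⟨!![0, 5; 3, 0], !![0, 5; 3, 0], by decide, by decide⟩ : GL (Fin 2) (ZMod 7)), (⟨!![5, 0; 3, 2], !![3, 0; 6, 4], by decide, by decide⟩ : GL (Fin 2) (ZMod 7))} : Set (GL (Fin 2) (ZMod 7)))))) → ((E.baseChange K).HasCM ∨ ∃ (hF : Literature.NumberTheory.Automorphic.isCompact_glFiniteIntegralLevel 2 K) (π : Literature.NumberTheory.Automorphic.CuspidalAutomorphicRepData 2 K hF), π.1.HasWeightZero ∧ ∀ᶠ w : IsDedekindDomain.HeightOneSpectrum (NumberField.RingOfIntegers K) in Filter.cofinite, ∃ α : Multiset ℂ, π.1.HasSatakeParamAt w α ∧ ((Real.sqrt w.residueCard : ℝ) : ℂ) * α.sum = (Literature.NumberTheory.Automorphic.frobTraceAt E w : ℂ))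

-- parent: RefinedLocusModular · child (gen 1)
/--     item stmt-Langlands-23413 · crux · rank 201 · open
    parent: RefinedLocusModular · by planner
    why it might fail: Rests on rank 0 of 15a/75b/75c over ℚ(√5) (exact L-values + Kolyvagin–Logachev), Katz injectivity at 11 and the identification X(b3,H8) ≅ X₀(75)^ε with the right twist; a wrong ε or one missed quadratic point of X₀(75)/w₂₅ over a totally real quartic K ∋ √5 with non-CM j ∉ ℚ(√5) refutes it.
    sources: Box2022, FreitasLeHungSiksek2015, BoxGajovicGoodman2021, DerickxNajmanSiksek2020
[crux] [certified finite datum] CERTIFICATE A of the `RefinedLocusModular` split — sheets 4.2 + 4.6;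
carrier X(b3,H8) = X₀(75)^ε (genus 5, the quadratic twist over k = ℚ(√5) of X₀(75) cut out by H8 =
the order-8 subgroup ⟨diag(2,3), antidiag(1,1)⟩ of the split Cartan normaliser at 5, det(H8) = {±1},
−1 ∈ H8 — generators as printed in the statement), coarse quotient C = X₀(75)/w₂₅ (genus 3, over ℚ).
STATEMENT: for K totally real quartic with √5 ∈ K and E/K (integral model, Δ ≠ 0) whose mod-3 image
is Borel in some framing, whose mod-5 image lies in H8 in some framing, and whose mod-7 image is
Borel or lies in G(e7) in some framing: E has geometric CM or j(E) ∈ ℚ(√5). The mod-7 disjunction is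
LOAD-BEARING: the pair-level statement b3 ∧ H8 ⇒ CM ∨ j ∈ ℚ(√5) is FALSE (orbit B: four non-CM
points of X₀(75)^ε over the totally real quartic K₁ = ℚ(θ), θ⁴ − 35θ² + 205, √5 ∈ K₁, with ℚ(j) = K₁
— they are LARGE AT 7 — neither Borel nor in G(e7) in any framing — on two lineages (eng-9 E11;
eng-8 E11-TWIN, Frobenius at 𝔓 | 13, 𝔓 | 19; kernel side: the
`not_framing_borel7_or_Ge7_of_witness…` anchors of Theorems/SqrtFiveQuarticCoversCertB3H8.lean,
p670819), so they lie on no refined curve; CENSUS -/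
@[route_item "route-Langlands-SqrtFiveQuarticCovers"]
def CertB3H8 : Prop :=
  ∀ (K : Type) [Field K] [NumberField K], NumberField.IsTotallyReal K → Module.finrank ℚ K = 4 → (∃ r : K, r ^ 2 = 5) → ∀ E : WeierstrassCurve (NumberField.RingOfIntegers K), E.Δ ≠ 0 → (∃ ρ : Literature.NumberTheory.GaloisRepresentations.FramedGaloisRep K (ZMod 3) 2, (∃ e : (E.baseChange K).geomTorsion ((3 : ℕ) : ℤ) ≃+ (Fin 2 → ZMod 3), ∀ (σ : Field.absoluteGaloisGroup K) (P : (E.baseChange K).geomTorsion ((3 : ℕ) : ℤ)), e (σ • P) = ((ρ σ : GL (Fin 2) (ZMod 3)) : Matrix (Fin 2) (Fin 2) (ZMod 3)) *ᵥ (e P)) ∧ ((∀ σ : Field.absoluteGaloisGroup K, (((ρ σ : GL (Fin 2) (ZMod 3)) : Matrix (Fin 2) (Fin 2) (ZMod 3)) 1 0 = 0)))) → (∃ ρ : Literature.NumberTheory.GaloisRepresentations.FramedGaloisRep K (ZMod 5) 2, (∃ e : (E.baseChange K).geomTorsion ((5 : ℕ) : ℤ) ≃+ (Fin 2 → ZMod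 5), ∀ (σ : Field.absoluteGaloisGroup K) (P : (E.baseChange K).geomTorsion ((5 : ℕ) : ℤ)), e (σ • P) = ((ρ σ : GL (Fin 2) (ZMod 5)) : Matrix (Fin 2) (Fin 2) (ZMod 5)) *ᵥ (e P)) ∧ ((∀ σ : Field.absoluteGaloisGroup K, (ρ σ : GL (Fin 2) (ZMod 5)) ∈ Subgroup.closure ({(⟨!![2, 0; 0, 3], !![3, 0; 0, 2], by decide, by decide⟩ : GL (Fin 2) (ZMod 5)), (⟨!![0, 1; 1, 0], !![0, 1; 1, 0], by decide, by decide⟩ : GL (Fin 2) (ZMod 5))} : Set (GL (Fin 2) (ZMod 5)))))) → ((∃ ρ : Literature.NumberTheory.GaloisRepresentations.FramedGaloisRep K (ZMod 7) 2, (∃ e : (E.baseChange K).geomTorsion ((7 : ℕ) : ℤ) ≃+ (Fin 2 → ZMod 7), ∀ (σ : Field.absoluteGaloisGroup K) (P : (E.baseChange K).geomTorsion ((7 : ℕ) : ℤ)), e (σ • P) = ((ρ σ : GL (Fin 2) (ZMod 7)) : Matrix (Fin 2) (Fin 2) (ZMod 7)) *ᵥ (e P)) ∧ ((∀ σ : Field.absoluteGaloisGroup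 K, (((ρ σ : GL (Fin 2) (ZMod 7)) : Matrix (Fin 2) (Fin 2) (ZMod 7)) 1 0 = 0)))) ∨ (∃ ρ : Literature.NumberTheory.GaloisRepresentations.FramedGaloisRep K (ZMod 7) 2, (∃ e : (E.baseChange K).geomTorsion ((7 : ℕ) : ℤ) ≃+ (Fin 2 → ZMod 7), ∀ (σ : Field.absoluteGaloisGroup K) (P : (E.baseChange K).geomTorsion ((7 : ℕ) : ℤ)), e (σ • P) = ((ρ σ : GL (Fin 2) (ZMod 7)) : Matrix (Fin 2) (Fin 2) (ZMod 7)) *ᵥ (e P)) ∧ ((∀ σ : Field.absoluteGaloisGroup K, (ρ σ : GL (Fin 2) (ZMod 7)) ∈ Subgroup.closure ({(⟨!![0, 5; 3, 0], !![0, 5; 3, 0], by decide, by decide⟩ : GL (Fin 2) (ZMod 7)), (⟨!![5, 0; 3, 2], !![3, 0; 6, 4], by decide, by decide⟩ : GL (Fin 2) (ZMod 7))} : Set (GL (Fin 2) (ZMod 7))))))) → ((E.baseChange K).HasCM ∨ (∃ r : K, r ^ 2 = 5 ∧ ∃ a b : ℚ, (E.baseChange K).c₄ ^ 3 = ((a :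 K) + (b : K) * r) * (E.baseChange K).Δ))

-- parent: RefinedLocusModular · child (gen 1)
/--     item stmt-Langlands-23414 · crux · rank 202 · open
    parent: RefinedLocusModular · by planner
    why it might fail: THEOREM Z rests on rank-0/Prym inputs for J(Z) over ℚ(√5) and an α-sieve not yet certnum-released (RQ-029), and on the model Z = Y_k ×_{ℙ¹} C₁₂ with the right twist (named identification); one missed non-CM quadratic point of Z over a totally real quartic K ∋ √5 with j ∉ ℚ(√5) refutes it.
    sources: Box2022, FreitasLeHungSiksek2015, BoxGajovicGoodman2021, DerickxNajmanSiksek2020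
[crux] [certified finite datum] CERTIFICATE B7 of the `RefinedLocusModular` split — sheets 4.1 + 4.3
(mod-3 condition free); carrier Z = X(H12,b7) (genus 9, over k = ℚ(√5); Z = Y_k ×_{ℙ¹_t} C₁₂ with Y
= X(ns⁺5,b7)/ℚ of genus 5; H12 = the order-12 subgroup ⟨(3,1;3,3), diag(1,4)⟩ of the non-split
Cartan normaliser at 5, det(H12) = {±1}, −1 ∈ H12 — generators as printed in the statement).
STATEMENT: for K totally real quartic with √5 ∈ K and E/K (integral model, Δ ≠ 0) whose mod-5 image
lies in H12 in some framing and whose mod-7 image is Borel in some framing: E has geometric CM or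
j(E) ∈ ℚ(√5). FINITE DATUM behind it (THEOREM Z; CENSUS §15 rows 4.1/4.3; SHEET-WORDS v0.2
(828c8ad09b15e9a5)): Z(k) = the 8 cusps; the quadratic points of Z over k are 2 CM pairs (j = −3375,
16581375, over K₁ = ℚ[x]/(x⁴ − 70x² + 245)) and 4 θ-pairs over ℚ[x]/(x⁴ − x³ − 2x² − 2x − 1)
(discriminant −475, signature (2,1): NOT totally real, hence outside the statement's range). THEOREM
Z has two halves (ref-2 R2-2 I2; lead 20:50:23Z): Z-B = no quadratic point of Z over k outside the
listed pairs — TWO lineages (producer lg-quartmod eng-2: README-E7 acceefaa15e0bd61, certnum-E7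
packet b7bc02aba12c49bf, models -/
@[route_item "route-Langlands-SqrtFiveQuarticCovers"]
def CertH12B7 : Prop :=
  ∀ (K : Type) [Field K] [NumberField K], NumberField.IsTotallyReal K → Module.finrank ℚ K = 4 → (∃ r : K, r ^ 2 = 5) → ∀ E : WeierstrassCurve (NumberField.RingOfIntegers K), E.Δ ≠ 0 → (∃ ρ : Literature.NumberTheory.GaloisRepresentations.FramedGaloisRep K (ZMod 5) 2, (∃ e : (E.baseChange K).geomTorsion ((5 : ℕ) : ℤ) ≃+ (Fin 2 → ZMod 5), ∀ (σ : Field.absoluteGaloisGroup K) (P : (E.baseChange K).geomTorsion ((5 : ℕ) : ℤ)), e (σ • P) = ((ρ σ : GL (Fin 2) (ZMod 5)) : Matrix (Fin 2) (Fin 2) (ZMod 5)) *ᵥ (e P)) ∧ ((∀ σ : Field.absoluteGaloisGroup K, (ρ σ : GL (Fin 2) (ZMod 5)) ∈ Subgroup.closure ({(⟨!![3, 1; 3, 3], !![3, 4; 2, 3], by decide, by decide⟩ : GL (Fin 2) (ZMod 5)), (⟨!![1, 0; 0, 4], !![1, 0; 0, 4], by decide, by decide⟩ : GL (Fin 2)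 (ZMod 5))} : Set (GL (Fin 2) (ZMod 5)))))) → (∃ ρ : Literature.NumberTheory.GaloisRepresentations.FramedGaloisRep K (ZMod 7) 2, (∃ e : (E.baseChange K).geomTorsion ((7 : ℕ) : ℤ) ≃+ (Fin 2 → ZMod 7), ∀ (σ : Field.absoluteGaloisGroup K) (P : (E.baseChange K).geomTorsion ((7 : ℕ) : ℤ)), e (σ • P) = ((ρ σ : GL (Fin 2) (ZMod 7)) : Matrix (Fin 2) (Fin 2) (ZMod 7)) *ᵥ (e P)) ∧ ((∀ σ : Field.absoluteGaloisGroup K, (((ρ σ : GL (Fin 2) (ZMod 7)) : Matrix (Fin 2) (Fin 2) (ZMod 7)) 1 0 = 0)))) → ((E.baseChange K).HasCM ∨ (∃ r : K, r ^ 2 = 5 ∧ ∃ a b : ℚ, (E.baseChange K).c₄ ^ 3 = ((a : K) + (b : K) * r) * (E.baseChange K).Δ))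

-- parent: RefinedLocusModular · child (gen 1)
/--     item stmt-Langlands-23415 · crux · rank 203 · open
    parent: RefinedLocusModular · by planner
    why it might fail: Rests on the identifications X(s3,H8) ≅ (X₀(225)/w₉)^ε and X(s3,s⁺5)/ℚ, on rank 0 over ℚ(√5) of 15a/75a/75b/75c/225-factors and their twists (Kolyvagin, Kato/Rubin; L-values exact) and on a complete degree-≤2 census; one missed non-CM quadratic point with j ∉ ℚ(√5) over a totally real K refutes it.
    sources: FreitasLeHungSiksek2015, Box2022, BoxGajovicGoodman2021, DerickxNajmanSiksek2020
[crux] [certified finite datum] CERTIFICATE C of the `RefinedLocusModular` split — sheets 4.4 + 4.8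
(mod-7 condition free); carrier X(s3,H8) (genus 9, over k = ℚ(√5); = (X₀(225)/w₉)^ε), coarse
quotient X(s3,s⁺5)/ℚ (genus 4, [FreitasLeHungSiksek2015 p. 26]); C_s⁺(3) = normaliser of the split
Cartan at 3. STATEMENT: for K totally real quartic with √5 ∈ K and E/K (integral model, Δ ≠ 0) whose
mod-3 image lies in C_s⁺(3) in some framing and whose mod-5 image lies in H8 in some framing: E has
geometric CM or j(E) ∈ ℚ(√5). FINITE DATUM behind it (CENSUS §15 rows 4.4/4.8; SHEET-WORDS v0.2
(828c8ad09b15e9a5)): the points of degree ≤ 2 of X(s3,H8) over k are exactly 8 cusps + 2 cusp pairs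
+ 6 CM points with j = −32768 + 2 CM points with j = 1728 — no non-CM point at all. Lineages: fine
curve eng-3 E9 (E9-RESULT.md, REPRO.md) and coarse curve eng-9 E9-COARSE (README c829be806a3a1821),
method-disjoint; certnum RELEASES l.131–l.134. NAMED INPUTS (cited, not proved in tree):
moduli/model identifications X(s3,H8) ≅ (X₀(225)/w₉)^ε, X(s3,s⁺5) (NF-K1); rank 0 over ℚ(√5) of 15a,
75a, 75b, 75c and the relevant 225-factors with their χ₅- /ψ-twists from exact L-values +
Kolyvagin–Logachev resp. Kato/Rub -/
@[route_item "route-Langlands-SqrtFiveQuarticCovers"]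
def CertS3H8 : Prop :=
  ∀ (K : Type) [Field K] [NumberField K], NumberField.IsTotallyReal K → Module.finrank ℚ K = 4 → (∃ r : K, r ^ 2 = 5) → ∀ E : WeierstrassCurve (NumberField.RingOfIntegers K), E.Δ ≠ 0 → (∃ ρ : Literature.NumberTheory.GaloisRepresentations.FramedGaloisRep K (ZMod 3) 2, (∃ e : (E.baseChange K).geomTorsion ((3 : ℕ) : ℤ) ≃+ (Fin 2 → ZMod 3), ∀ (σ : Field.absoluteGaloisGroup K) (P : (E.baseChange K).geomTorsion ((3 : ℕ) : ℤ)), e (σ • P) = ((ρ σ : GL (Fin 2) (ZMod 3)) : Matrix (Fin 2) (Fin 2) (ZMod 3)) *ᵥ (e P)) ∧ ((∀ σ : Field.absoluteGaloisGroup K, (ρ σ : GL (Fin 2) (ZMod 3)) ∈ Subgroup.closure ({(⟨!![1, 0; 0, 2], !![1, 0; 0, 2], by decide, by decide⟩ : GL (Fin 2) (ZMod 3)), (⟨!![0, 1; 1, 0], !![0, 1; 1, 0], by decide, by decide⟩ : GL (Fin 2) (ZMod 3))} : Set (GL (Fin 2) (ZMod 3)))))) → (∃ ρ : Literature.NumberTheory.GaloisRepresentations.FramedGaloisRep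 K (ZMod 5) 2, (∃ e : (E.baseChange K).geomTorsion ((5 : ℕ) : ℤ) ≃+ (Fin 2 → ZMod 5), ∀ (σ : Field.absoluteGaloisGroup K) (P : (E.baseChange K).geomTorsion ((5 : ℕ) : ℤ)), e (σ • P) = ((ρ σ : GL (Fin 2) (ZMod 5)) : Matrix (Fin 2) (Fin 2) (ZMod 5)) *ᵥ (e P)) ∧ ((∀ σ : Field.absoluteGaloisGroup K, (ρ σ : GL (Fin 2) (ZMod 5)) ∈ Subgroup.closure ({(⟨!![2, 0; 0, 3], !![3, 0; 0, 2], by decide, by decide⟩ : GL (Fin 2) (ZMod 5)), (⟨!![0, 1; 1, 0], !![0, 1; 1, 0], by decide, by decide⟩ : GL (Fin 2) (ZMod 5))} : Set (GL (Fin 2) (ZMod 5)))))) → ((E.baseChange K).HasCM ∨ (∃ r : K, r ^ 2 = 5 ∧ ∃ a b : ℚ, (E.baseChange K).c₄ ^ 3 = ((a : K) + (b : K) * r) * (E.baseChange K).Δ))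

-- parent: RefinedLocusModular · child (gen 1)
/--     item stmt-Langlands-23416 · crux · rank 204 · open
    parent: RefinedLocusModular · by planner
    why it might fail: Rests on the model of X(b3,e7) (FLS's X_ns⁺(7) hauptmodul + the level-3 correspondence Ψ₃, named), on rank 0 of 49a4 and its twists over ℚ(√5) (exact L-values + Kolyvagin–Logachev) and a 0-dim closed-point census; an error in Ψ₃/branch data or a missed component with non-CM j ∉ ℚ(√5) refutes it.
    sources: FreitasLeHungSiksek2015, Box2022, DerickxNajmanSiksek2020
[crux] [certified finite datum] CERTIFICATE E of the `RefinedLocusModular` split — sheet 4.5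
(redundantly 4.6; mod-5 condition free); carrier X(b3,e7) (genus 9, defined over ℚ: FLS's
X_ns⁺(7)-hauptmodul model of X(e7) with the level-3 correspondence Ψ₃ of bidegree (4,4)); G(e7) =
the order-48 subgroup ⟨(0,5;3,0), (5,0;3,2)⟩ of GL₂(𝔽₇) of FLS's curve X(e7) (−1 ∈ G(e7); generators
as printed in the statement) [FreitasLeHungSiksek2015 §5]. STATEMENT: for K totally real quartic
with √5 ∈ K and E/K (integral model, Δ ≠ 0) whose mod-3 image is Borel in some framing and whose
mod-7 image lies in G(e7) in some framing: E has geometric CM or j(E) ∈ ℚ(√5). FINITE DATUM behind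
it (CENSUS §15 row 4.5; SHEET-WORDS v0.2 (828c8ad09b15e9a5)): X(e7)(k) = X(e7)(ℚ) = {O, T₀},
X(b3,e7)(k) = X(b3,e7)(ℚ) = the two points with j = 0; with φ = (forget-3, forget-3 ∘ w₃) : X(b3,e7)
→ 49a4 × 49a4 (rank 0 over k) the closed-point census of {Ψ₃ = 0, Ψ₃^τ = 0} ∪ the m×id / id×m
intersections carries, in degree ≤ 2 over k, only (−1/3, −1/3) [j = 0] and the √21-orbit [j = 0,
over ℚ(√5,√21)]; hence every quadratic point of X(b3,e7) over k is ν₇-type (j ∈ k) or CM — EMPTY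
exceptional list. Lineages (FOUR per lead H -/
@[route_item "route-Langlands-SqrtFiveQuarticCovers"]
def CertB3E7 : Prop :=
  ∀ (K : Type) [Field K] [NumberField K], NumberField.IsTotallyReal K → Module.finrank ℚ K = 4 → (∃ r : K, r ^ 2 = 5) → ∀ E : WeierstrassCurve (NumberField.RingOfIntegers K), E.Δ ≠ 0 → (∃ ρ : Literature.NumberTheory.GaloisRepresentations.FramedGaloisRep K (ZMod 3) 2, (∃ e : (E.baseChange K).geomTorsion ((3 : ℕ) : ℤ) ≃+ (Fin 2 → ZMod 3), ∀ (σ : Field.absoluteGaloisGroup K) (P : (E.baseChange K).geomTorsion ((3 : ℕ) : ℤ)), e (σ • P) = ((ρ σ : GL (Fin 2) (ZMod 3)) : Matrix (Fin 2) (Fin 2) (ZMod 3)) *ᵥ (e P)) ∧ ((∀ σ : Field.absoluteGaloisGroup K, (((ρ σ : GL (Fin 2) (ZMod 3)) : Matrix (Fin 2) (Fin 2) (ZMod 3)) 1 0 = 0)))) → (∃ ρ : Literature.NumberTheory.GaloisRepresentations.FramedGaloisRep K (ZMod 7) 2, (∃ e : (E.baseChange K).geomTorsion ((7 : ℕ)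 : ℤ) ≃+ (Fin 2 → ZMod 7), ∀ (σ : Field.absoluteGaloisGroup K) (P : (E.baseChange K).geomTorsion ((7 : ℕ) : ℤ)), e (σ • P) = ((ρ σ : GL (Fin 2) (ZMod 7)) : Matrix (Fin 2) (Fin 2) (ZMod 7)) *ᵥ (e P)) ∧ ((∀ σ : Field.absoluteGaloisGroup K, (ρ σ : GL (Fin 2) (ZMod 7)) ∈ Subgroup.closure ({(⟨!![0, 5; 3, 0], !![0, 5; 3, 0], by decide, by decide⟩ : GL (Fin 2) (ZMod 7)), (⟨!![5, 0; 3, 2], !![3, 0; 6, 4], by decide, by decide⟩ : GL (Fin 2) (ZMod 7))} : Set (GL (Fin 2) (ZMod 7)))))) → ((E.baseChange K).HasCM ∨ (∃ r : K, r ^ 2 = 5 ∧ ∃ a b : ℚ, (E.baseChange K).c₄ ^ 3 = ((a : K) + (b : K) * r) * (E.baseChange K).Δ))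

-- parent: RefinedLocusModular · child (gen 1)
/--     item stmt-Langlands-23417 · crux · rank 205 · open
    parent: RefinedLocusModular · by planner
    why it might fail: Rests on CASE 2 EMPTY for X(s3,H12) → X(s3,ns⁺5) (Prym rank 0 via exact L-values + Kolyvagin–Logachev/Kato, #tors | 80, torsion injectivity, étale lift) and on the 11 exceptional quadratic classes not lifting (B ∉ K²); RQ-028 partly released, E12 running; one lifted class with non-CM j refutes it.
    sources: Box2022, BoxGajovicGoodman2021, FreitasLeHungSiksek2015, DerickxNajmanSiksek2020
[crux] [certified finite datum] CERTIFICATE D of the `RefinedLocusModular` split — sheet 4.7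
(redundantly 4.3; mod-7 condition free); carrier X(s3,H12) (genus 7, over k = ℚ(√5)), an étale
double cover over k of X(s3,ns⁺5)/ℚ (genus 3, plane quartic over 225a1). STATEMENT: for K totally
real quartic with √5 ∈ K and E/K (integral model, Δ ≠ 0) whose mod-3 image lies in C_s⁺(3) in some
framing and whose mod-5 image lies in H12 in some framing: E has geometric CM or j(E) ∈ ℚ(√5).
FINITE DATUM behind it (CENSUS §15 row 4.7; SHEET-WORDS v0.2 (828c8ad09b15e9a5)): X(s3,H12)(k) = 8
cusps; every quadratic point of X(s3,H12) over k is a cusp or is CASE 1 = lies over a k-rational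
point R of X(ns3,ns⁺5) = 225a1 (rank 1 over k), hence j = J₇(t(R)) ∈ k (NOT a finite list — Y₁ =
X(ns3,H12)(k) is not enumerated and need not be; known CASE-1 examples j = 0, 8000 (CM) and −28079 ±
12510√5, the latter lying over QUADRATIC points of X(s3,ns⁺5), whose k-points are exactly the 8 of
THEOREM (R′): 4 cusps + j ∈ {0, 8000}); CASE 2 EMPTY = no quadratic point of X(s3,H12) over k lies
over a non-k-rational point of 225a1 (X-version Prym sieve, 39/39 classes X-certified, two
lineages); in particular the 18 known -/
@[route_item "route-Langlands-SqrtFiveQuarticCovers"]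
def CertS3H12 : Prop :=
  ∀ (K : Type) [Field K] [NumberField K], NumberField.IsTotallyReal K → Module.finrank ℚ K = 4 → (∃ r : K, r ^ 2 = 5) → ∀ E : WeierstrassCurve (NumberField.RingOfIntegers K), E.Δ ≠ 0 → (∃ ρ : Literature.NumberTheory.GaloisRepresentations.FramedGaloisRep K (ZMod 3) 2, (∃ e : (E.baseChange K).geomTorsion ((3 : ℕ) : ℤ) ≃+ (Fin 2 → ZMod 3), ∀ (σ : Field.absoluteGaloisGroup K) (P : (E.baseChange K).geomTorsion ((3 : ℕ) : ℤ)), e (σ • P) = ((ρ σ : GL (Fin 2) (ZMod 3)) : Matrix (Fin 2) (Fin 2) (ZMod 3)) *ᵥ (e P)) ∧ ((∀ σ : Field.absoluteGaloisGroup K, (ρ σ : GL (Fin 2) (ZMod 3)) ∈ Subgroup.closure ({(⟨!![1, 0; 0, 2], !![1, 0; 0, 2], by decide, by decide⟩ : GL (Fin 2) (ZMod 3)), (⟨!![0, 1; 1, 0], !![0, 1; 1, 0], by decide, by decide⟩ : GL (Fin 2) (ZMod 3))} : Set (GL (Fin 2) (ZMod 3)))))) → (∃ ρ : Literature.NumberTheory.GaloisRepresentations.FramedGaloisRep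 K (ZMod 5) 2, (∃ e : (E.baseChange K).geomTorsion ((5 : ℕ) : ℤ) ≃+ (Fin 2 → ZMod 5), ∀ (σ : Field.absoluteGaloisGroup K) (P : (E.baseChange K).geomTorsion ((5 : ℕ) : ℤ)), e (σ • P) = ((ρ σ : GL (Fin 2) (ZMod 5)) : Matrix (Fin 2) (Fin 2) (ZMod 5)) *ᵥ (e P)) ∧ ((∀ σ : Field.absoluteGaloisGroup K, (ρ σ : GL (Fin 2) (ZMod 5)) ∈ Subgroup.closure ({(⟨!![3, 1; 3, 3], !![3, 4; 2, 3], by decide, by decide⟩ : GL (Fin 2) (ZMod 5)), (⟨!![1, 0; 0, 4], !![1, 0; 0, 4], by decide, by decide⟩ : GL (Fin 2) (ZMod 5))} : Set (GL (Fin 2) (ZMod 5)))))) → ((E.baseChange K).HasCM ∨ (∃ r : K, r ^ 2 = 5 ∧ ∃ a b : ℚ, (E.baseChange K).c₄ ^ 3 = ((a : K) + (b : K) * r) * (E.baseChange K).Δ))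

-- parent: RefinedLocusModular · glue (gen 1)
/--     item stmt-Langlands-23418 · support · rank 206 · open
    parent: RefinedLocusModular · GLUE: children ⟹ parent · by planner
GLUE children ⟹ parent (support; OPEN-as-conditional by design): CertB3H8 → CertH12B7 → CertS3H8 →
CertB3E7 → CertS3H12 → RefinedLocusModular. Proof shape: split the crux's image disjunctions at 3,
5, 7 into eight cases; in each, one certificate applies (H8-branch: CertB3H8 if b3 — it consumes the
mod-7 disjunction —, CertS3H8 if s3; H12-branch: CertH12B7 if b7, else CertB3E7 if b3, CertS3H12 if
s3) and yields geometric CM (the first disjunct of modularity) or j(E) ∈ ℚ(√5); then the PRINTED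
bridge «j(E) ∈ ℚ(√5), K ∋ √5 totally real quartic ⇒ E modular» = FLS 2015 Thm 1 over ℚ(√5) + cyclic
(solvable) base change ℚ(√5) → K (Thorne 2016 L7.1) + quadratic twist, tree theorem
`Theorems.SqrtFiveQuarticCovers.jInSqrtFive_modular_of_facts` (p651445). Kernel proof MODULO EXACTLY
the two named printed facts `Literature.NumberTheory.Automorphic.FLS2015_theorem1` and
`…isModularEllipticCurve_baseChange_of_isSolvable_of_isAutomorphicOfWeightZero`:
`Theorems/SqrtFiveQuarticCoversCertificates.refinedLocusModular_of_certificates` (p653708;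
hypotheses hA hB7 hC hD hE = the five children verbatim), restated over the child decls as
`refinedLocusModularGlue_of_facts` in Theorems/SqrtFiveQuarticCoversS -/
@[route_item "route-Langlands-SqrtFiveQuarticCovers"]
def RefinedLocusModularGlue : Prop :=
  CertB3H8 → CertH12B7 → CertS3H8 → CertB3E7 → CertS3H12 → RefinedLocusModular

-- earlier ReductionToRefinedLocus (stmt-Langlands-17589, replaced 2026-08-16T23:24:40Z -> stmt-Langlands-17632): retired by None — ∀ (K : Type) [Field K] [NumberField K], NumberField.IsTotallyReal K → Module.finrank ℚ K = 4 → (∃ r : K, r ^ 2 = 5) → ∀ E : WeierstrassCurve (NumberField.RingOfIntegers K), E.Δ ≠ 0 → ¬ Literature.NumberTheory.Automorphic.IsModularEllipticCurve K E → (∃ ρ : Literature.Num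
-- earlier ReductionToRefinedLocus (stmt-Langlands-17632, replaced 2026-08-16T23:40:01Z -> stmt-Langlands-17834): retired by None — ∀ (K : Type) [Field K] [NumberField K], NumberField.IsTotallyReal K → Module.finrank ℚ K = 4 → (∃ r : K, r ^ 2 = 5) → ∀ E : WeierstrassCurve (NumberField.RingOfIntegers K), E.Δ ≠ 0 → ¬ Literature.NumberTheory.Automorphic.IsModularEllipticCurve K E → (∃ ρ : Literature.Num
/-- item stmt-Langlands-17834 · crux · rank 3 · open · by planner
why it might fail: the printed 7-adic inputs (Kalyanswamy's d7 elimination, the FLS e7 refinement) or the ordinary/pot-BT case split at v ∣ p for additive reduction may carry a hypothesis that fails for some quartic K ∋ √5 with 7 or 3 ramified; then w7 must be widened to {b7, d7, e7} (12 curves).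
sources: FreitasLeHungSiksek2015, Kalyanswamy2018, Thorne2016, KisinModuli2009, Box2022
[crux] for K totally real quartic with √5 ∈ K and E/K elliptic NOT modular: ρ̄_{E,3} is Borel or
lands in C_s⁺(3); ρ̄_{E,5} is Borel or lands in H8 = ⟨diag(2,3), antidiag(1,1)⟩ or H12 = ⟨(3 1;3 3),
diag(1,4)⟩; ρ̄_{E,7} is Borel or lands in G(e7) (each for some framing of E[p]). Here 'ρ is the
mod-p representation of E in some framing' is `WeierstrassCurve.IsTorsionGaloisRep p ρ` written out
by its definition: a ℤ/p-linear isomorphism e : E[p](K̄) ≃ (ℤ/p)² with e(σ•P) = ρ(σ)·e(P). 'Modular'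
is `IsModularEllipticCurve K E` written out by its definition (cone repair). Chain: FLS Thms 3–4 ⇒
each ρ̄_{E,p}(G_{K(ζ_p)}) absolutely reducible; FLS Prop. 3.1/Lemma 3.2; p = 3 Rubin/FLS Prop.
1.1(a); p = 5: det = ε̄₅ ∈ {±1} (√5 ∈ K), complex conjugation odd, and the certified census
GroupCensusFive (support item; compute/census_gl2f5.py) ⇒ H8/H12; p = 7 Kalyanswamy + FLS e7 (K ∩
ℚ(ζ₇) = ℚ). -/
@[route_item "route-Langlands-SqrtFiveQuarticCovers"]
def ReductionToRefinedLocus : Prop :=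
  ∀ (K : Type) [Field K] [NumberField K], NumberField.IsTotallyReal K → Module.finrank ℚ K = 4 → (∃ r : K, r ^ 2 = 5) → ∀ E : WeierstrassCurve (NumberField.RingOfIntegers K), E.Δ ≠ 0 → ¬ ((E.baseChange K).HasCM ∨ ∃ (hF : Literature.NumberTheory.Automorphic.isCompact_glFiniteIntegralLevel 2 K) (π : Literature.NumberTheory.Automorphic.CuspidalAutomorphicRepData 2 K hF), π.1.HasWeightZero ∧ ∀ᶠ w : IsDedekindDomain.HeightOneSpectrum (NumberField.RingOfIntegers K) in Filter.cofinite, ∃ α : Multiset ℂ, π.1.HasSatakeParamAt w α ∧ ((Real.sqrt w.residueCard : ℝ) : ℂ) * α.sum = (Literature.NumberTheory.Automorphic.frobTraceAt E w : ℂ)) → (∃ ρ : Literature.NumberTheory.GaloisRepresentations.FramedGaloisRep K (ZMod 3) 2, (∃ e : (E.baseChange K).geomTorsion ((3 : ℕ) : ℤ) ≃+ (Fin 2 → ZMod 3), ∀ (σ : Field.absoluteGaloisGroup K) (P : (E.baseChange K).geomTorsion ((3 : ℕ) : ℤ)), e (σ • P) = ((ρ σ : GL (Fin 2) (ZMod 3))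 : Matrix (Fin 2) (Fin 2) (ZMod 3)) *ᵥ (e P)) ∧ ((∀ σ : Field.absoluteGaloisGroup K, (((ρ σ : GL (Fin 2) (ZMod 3)) : Matrix (Fin 2) (Fin 2) (ZMod 3)) 1 0 = 0)) ∨ (∀ σ : Field.absoluteGaloisGroup K, (ρ σ : GL (Fin 2) (ZMod 3)) ∈ Subgroup.closure ({(⟨!![1, 0; 0, 2], !![1, 0; 0, 2], by decide, by decide⟩ : GL (Fin 2) (ZMod 3)), (⟨!![0, 1; 1, 0], !![0, 1; 1, 0], by decide, by decide⟩ : GL (Fin 2) (ZMod 3))} : Set (GL (Fin 2) (ZMod 3)))))) ∧ ((∃ ρ : Literature.NumberTheory.GaloisRepresentations.FramedGaloisRep K (ZMod 5) 2, (∃ e : (E.baseChange K).geomTorsion ((5 : ℕ) : ℤ) ≃+ (Fin 2 → ZMod 5), ∀ (σ : Field.absoluteGaloisGroup K) (P : (E.baseChange K).geomTorsion ((5 : ℕ) : ℤ)), e (σ • P) = ((ρ σ : GL (Fin 2) (ZMod 5)) : Matrix (Fin 2) (Fin 2) (ZMod 5)) *ᵥ (e P)) ∧ (∀ σ : Field.absoluteGaloisGroup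 K, (((ρ σ : GL (Fin 2) (ZMod 5)) : Matrix (Fin 2) (Fin 2) (ZMod 5)) 1 0 = 0))) ∨ (∃ ρ : Literature.NumberTheory.GaloisRepresentations.FramedGaloisRep K (ZMod 5) 2, (∃ e : (E.baseChange K).geomTorsion ((5 : ℕ) : ℤ) ≃+ (Fin 2 → ZMod 5), ∀ (σ : Field.absoluteGaloisGroup K) (P : (E.baseChange K).geomTorsion ((5 : ℕ) : ℤ)), e (σ • P) = ((ρ σ : GL (Fin 2) (ZMod 5)) : Matrix (Fin 2) (Fin 2) (ZMod 5)) *ᵥ (e P)) ∧ ((∀ σ : Field.absoluteGaloisGroup K, (ρ σ : GL (Fin 2) (ZMod 5)) ∈ Subgroup.closure ({(⟨!![2, 0; 0, 3], !![3, 0; 0, 2], by decide, by decide⟩ : GL (Fin 2) (ZMod 5)), (⟨!![0, 1; 1, 0], !![0, 1; 1, 0], by decide, by decide⟩ : GL (Fin 2) (ZMod 5))} : Set (GL (Fin 2) (ZMod 5)))) ∨ (∀ σ : Field.absoluteGaloisGroup K, (ρ σ : GL (Fin 2) (ZMod 5)) ∈ Subgroup.closure ({(⟨!![3, 1; 3,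 3], !![3, 4; 2, 3], by decide, by decide⟩ : GL (Fin 2) (ZMod 5)), (⟨!![1, 0; 0, 4], !![1, 0; 0, 4], by decide, by decide⟩ : GL (Fin 2) (ZMod 5))} : Set (GL (Fin 2) (ZMod 5))))))) ∧ (∃ ρ : Literature.NumberTheory.GaloisRepresentations.FramedGaloisRep K (ZMod 7) 2, (∃ e : (E.baseChange K).geomTorsion ((7 : ℕ) : ℤ) ≃+ (Fin 2 → ZMod 7), ∀ (σ : Field.absoluteGaloisGroup K) (P : (E.baseChange K).geomTorsion ((7 : ℕ) : ℤ)), e (σ • P) = ((ρ σ : GL (Fin 2) (ZMod 7)) : Matrix (Fin 2) (Fin 2) (ZMod 7)) *ᵥ (e P)) ∧ ((∀ σ : Field.absoluteGaloisGroup K, (((ρ σ : GL (Fin 2) (ZMod 7)) : Matrix (Fin 2) (Fin 2) (ZMod 7)) 1 0 = 0)) ∨ (∀ σ : Field.absoluteGaloisGroup K, (ρ σ : GL (Fin 2) (ZMod 7)) ∈ Subgroup.closure ({(⟨!![0, 5; 3, 0], !![0, 5; 3, 0], by decide, by decide⟩ : GL (Fin 2) (ZMod 7)), (⟨!![5, 0;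 3, 2], !![3, 0; 6, 4], by decide, by decide⟩ : GL (Fin 2) (ZMod 7))} : Set (GL (Fin 2) (ZMod 7))))))

-- earlier BoxBorelFive (stmt-Langlands-17590, replaced 2026-08-16T23:40:01Z -> stmt-Langlands-17835): retired by None — ∀ (K : Type) [Field K] [NumberField K], NumberField.IsTotallyReal K → Module.finrank ℚ K = 4 → (∃ r : K, r ^ 2 = 5) → ∀ E : WeierstrassCurve (NumberField.RingOfIntegers K), E.Δ ≠ 0 → (∃ ρ : Literature.NumberTheory.GaloisRepresentations.FramedGaloisRep K (ZMod 3) 2, (E.baseChange K)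
/-- item stmt-Langlands-17835 · crux · rank 4 · open · by planner
why it might fail: Box's sieve might have used the standing hypothesis √5 ∉ K to discard quartic points over fields containing √5 (it should enter only through his Thm 1.2); if so those points must be re-sieved over ℚ(√5).
sources: Box2022, Box2021, BoxGajovicGoodman2021
[crux] for K totally real quartic with √5 ∈ K and E/K elliptic with mod-3 image Borel or in C_s⁺(3),
mod-5 image BOREL, mod-7 image Borel or in G(e7): E is modular
(`Literature.NumberTheory.Automorphic.IsModularEllipticCurve K E`, written out by its definition so
that the route file imports only the summit Statement's cone: geometric CM, or a weight-zero
cuspidal π of GL₂(𝔸_K) whose T_w-eigenvalue is a_w(E) at cofinitely many finite places w) — because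
E then gives a quartic point on X₀(105), X(s3,b5,b7), X(b3,b5,e7) or X(s3,b5,e7), and Box2022 §§3–6
determined ALL quartic points of these four curves (the only ones over a field containing √5 are the
CM points of discriminant −20 over ℚ(√5, i), his Prop. (quadptprop)(v) and Remark 4.7), every
non-cuspidal one being CM or a ℚ-curve or of rational j. Here 'ρ is the mod-p representation of E in
some framing' is `WeierstrassCurve.IsTorsionGaloisRep p ρ` written out by its definition: a
ℤ/p-linear isomorphism e : E[p](K̄) ≃ (ℤ/p)² with e(σ•P) = ρ(σ)·e(P). [difficulty: M] -/
@[route_item "route-Langlands-SqrtFiveQuarticCovers"]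
def BoxBorelFive : Prop :=
  ∀ (K : Type) [Field K] [NumberField K], NumberField.IsTotallyReal K → Module.finrank ℚ K = 4 → (∃ r : K, r ^ 2 = 5) → ∀ E : WeierstrassCurve (NumberField.RingOfIntegers K), E.Δ ≠ 0 → (∃ ρ : Literature.NumberTheory.GaloisRepresentations.FramedGaloisRep K (ZMod 3) 2, (∃ e : (E.baseChange K).geomTorsion ((3 : ℕ) : ℤ) ≃+ (Fin 2 → ZMod 3), ∀ (σ : Field.absoluteGaloisGroup K) (P : (E.baseChange K).geomTorsion ((3 : ℕ) : ℤ)), e (σ • P) = ((ρ σ : GL (Fin 2) (ZMod 3)) : Matrix (Fin 2) (Fin 2) (ZMod 3)) *ᵥ (e P)) ∧ ((∀ σ : Field.absoluteGaloisGroup K, (((ρ σ : GL (Fin 2) (ZMod 3)) : Matrix (Fin 2) (Fin 2) (ZMod 3)) 1 0 = 0)) ∨ (∀ σ : Field.absoluteGaloisGroup K, (ρ σ : GL (Fin 2) (ZMod 3)) ∈ Subgroup.closure ({(⟨!![1, 0; 0, 2], !![1, 0; 0, 2], by decide, by decide⟩ : GL (Fin 2) (ZMod 3)), (⟨!![0,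 1; 1, 0], !![0, 1; 1, 0], by decide, by decide⟩ : GL (Fin 2) (ZMod 3))} : Set (GL (Fin 2) (ZMod 3)))))) → (∃ ρ : Literature.NumberTheory.GaloisRepresentations.FramedGaloisRep K (ZMod 5) 2, (∃ e : (E.baseChange K).geomTorsion ((5 : ℕ) : ℤ) ≃+ (Fin 2 → ZMod 5), ∀ (σ : Field.absoluteGaloisGroup K) (P : (E.baseChange K).geomTorsion ((5 : ℕ) : ℤ)), e (σ • P) = ((ρ σ : GL (Fin 2) (ZMod 5)) : Matrix (Fin 2) (Fin 2) (ZMod 5)) *ᵥ (e P)) ∧ (∀ σ : Field.absoluteGaloisGroup K, (((ρ σ : GL (Fin 2) (ZMod 5)) : Matrix (Fin 2) (Fin 2) (ZMod 5)) 1 0 = 0))) → (∃ ρ : Literature.NumberTheory.GaloisRepresentations.FramedGaloisRep K (ZMod 7) 2, (∃ e : (E.baseChange K).geomTorsion ((7 : ℕ) : ℤ) ≃+ (Fin 2 → ZMod 7), ∀ (σ : Field.absoluteGaloisGroup K) (P : (E.baseChange K).geomTorsion ((7 : ℕ) : ℤ)), e (σ • P) = ((ρ σ : GL (Fin 2) (ZMod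 7)) : Matrix (Fin 2) (Fin 2) (ZMod 7)) *ᵥ (e P)) ∧ ((∀ σ : Field.absoluteGaloisGroup K, (((ρ σ : GL (Fin 2) (ZMod 7)) : Matrix (Fin 2) (Fin 2) (ZMod 7)) 1 0 = 0)) ∨ (∀ σ : Field.absoluteGaloisGroup K, (ρ σ : GL (Fin 2) (ZMod 7)) ∈ Subgroup.closure ({(⟨!![0, 5; 3, 0], !![0, 5; 3, 0], by decide, by decide⟩ : GL (Fin 2) (ZMod 7)), (⟨!![5, 0; 3, 2], !![3, 0; 6, 4], by decide, by decide⟩ : GL (Fin 2) (ZMod 7))} : Set (GL (Fin 2) (ZMod 7)))))) → ((E.baseChange K).HasCM ∨ ∃ (hF : Literature.NumberTheory.Automorphic.isCompact_glFiniteIntegralLevel 2 K) (π : Literature.NumberTheory.Automorphic.CuspidalAutomorphicRepData 2 K hF), π.1.HasWeightZero ∧ ∀ᶠ w : IsDedekindDomain.HeightOneSpectrum (NumberField.RingOfIntegers K) in Filter.cofinite, ∃ α : Multiset ℂ, π.1.HasSatakeParamAt w α ∧ ((Real.sqrt w.residueCard : ℝ) : ℂ) * α.sum = (Literature.NumberTheory.Automorphic.frobTraceAt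 E w : ℂ))

-- earlier BoxQuartic (stmt-Langlands-17591, replaced 2026-08-16T23:40:01Z -> stmt-Langlands-17836): retired by None — ∀ (K : Type) [Field K] [NumberField K], NumberField.IsTotallyReal K → Module.finrank ℚ K = 4 → (¬ ∃ r : K, r ^ 2 = 5) → ∀ E : WeierstrassCurve (NumberField.RingOfIntegers K), E.Δ ≠ 0 → Literature.NumberTheory.Automorphic.IsModularEllipticCurve K E
/-- item stmt-Langlands-17836 · crux · rank 9 · open · by planner
why it might fail: none mathematically (Box2022 Thm 1.1 is a published theorem); in-tree it is consumed only after vendoring as a named fact in the Caraiani–Newton rendering of 'modular' (CM or weight-zero cuspidal π with cofinite trace matching) — the risk is a rendering mismatch, not falsity.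
sources: Box2022
[support] Box's theorem: every elliptic curve over a totally real quartic field NOT containing √5 is
modular (`Literature.NumberTheory.Automorphic.IsModularEllipticCurve K E`, written out by its
definition so that the route file imports only the summit Statement's cone: geometric CM, or a
weight-zero cuspidal π of GL₂(𝔸_K) whose T_w-eigenvalue is a_w(E) at cofinitely many finite places
w) (a printed theorem; to be vendored as a named fact and consumed as a hypothesis). [difficulty:
provable-now] -/
@[route_item "route-Langlands-SqrtFiveQuarticCovers"]
def BoxQuartic : Prop :=
  ∀ (K : Type) [Field K] [NumberField K], NumberField.IsTotallyReal K → Module.finrank ℚ K = 4 → (¬ ∃ r : K, r ^ 2 = 5) → ∀ E : WeierstrassCurve (NumberField.RingOfIntegers K), E.Δ ≠ 0 → ((E.baseChange K).HasCM ∨ ∃ (hF : Literature.NumberTheory.Automorphic.isCompact_glFiniteIntegralLevel 2 K) (π : Literature.NumberTheory.Automorphic.CuspidalAutomorphicRepData 2 K hF), π.1.HasWeightZero ∧ ∀ᶠ w : IsDedekindDomain.HeightOneSpectrum (NumberField.RingOfIntegers K) in Filter.cofinite, ∃ α : Multiset ℂ, π.1.HasSatakeParamAt w α ∧ ((Real.sqrt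 w.residueCard : ℝ) : ℂ) * α.sum = (Literature.NumberTheory.Automorphic.frobTraceAt E w : ℂ))

/-- item stmt-Langlands-2175 · crux · rank 9 · open · by planner
why it might fail: it is the rest of the summit (direction (A), every other (n, F), local–global compatibility, the data 𝓡): conjecture-grade, unprovable short of Langlands itself; never staffed from this route — graders judge RefinedLocusModular / ReductionToRefinedLocus / BoxBorelFive.
sources: BuzzardGeeLMS2014, Box2022
[assembly] Target -> Langlands. GLUE, provable with tree facts as hypotheses where needed: fix F,
take Rec from Target; (A) is the first conjunct verbatim. For (B): given rho irreducible and
Rec-geometric, weak (B) gives pi L-algebraic cuspidal with Satake matching a.e.; (A) applied to pi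
gives rho' irreducible geometric with `Corresponds Rec ι π.1 ρ'`; rho and rho' have equal Frobenius
characteristic polynomials at cofinitely many v (both match the same Satake parameters;
`hasSatakeParamAt` is unique), hence are GL_n(Q̄_l)-conjugate by Chebotarev density + Brauer-Nesbitt
for irreducible l-adic representations (tree: `LAdicRepFrobenius`,
`ReciprocityGLnGaloisConjProofs`); finally `Corresponds Rec ι π.1` is invariant under
`FramedRep.conj g` (Satake clause: `isUnramifiedAt_conj_iff` + charpoly conjugation-invariance;
local-global clause: `PstWeilDeligneData.conj`, conjugation of the Weil-Deligne datum r in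
`IsWeilDeligneOfLadic`, `IsTransportAlong`, `HasFrobSemisimpleClass` is a class function). If a
needed invariance of an accepted predicate is not provable as stated, file it as a support lemma
with `--supports Assembly` rather than weakening Target. -/
@[route_item "route-Langlands-SqrtFiveQuarticCovers"]
def SectorComplement : Prop :=
  Target → _root_.Langlands

/-- item stmt-Langlands-17592 · support · rank 9 · closed · proved by Summit.Langlands.Langlands.Theorems.GroupCensusFive.groupCensusFive_proof (prover) · by planner
sources: FreitasLeHungSiksek2015
[support] [finite certificate, decidable] every subgroup G ≤ GL₂(𝔽₅) with det(G) ⊆ {±1}, containing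
an element of trace 0 and determinant −1, acting irreducibly on 𝔽₅², whose determinant-1 part does
not span M₂(𝔽₅) (= is absolutely reducible, Burnside), is conjugate into H8 or into H12. USED BY
`closes` (it turns the Cartan data of ReductionToRefinedLocus into the H8/H12 framing of
RefinedLocusModular). Verified by exhaustive enumeration (compute/census_gl2f5.py: 243 subgroups of
{det = ±1}, 45 bad of orders 6, 8, 12, all conjugate into H8/H12); in-kernel target:
`decide`/`native_decide` over `GL (Fin 2) (ZMod 5)`, else a kit certificate listing the conjugators.
[difficulty: provable-now] -/
@[route_item "route-Langlands-SqrtFiveQuarticCovers"]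
def GroupCensusFive : Prop :=
  ∀ G : Subgroup (GL (Fin 2) (ZMod 5)), (∀ g ∈ G, Matrix.det ((g : GL (Fin 2) (ZMod 5)) : Matrix (Fin 2) (Fin 2) (ZMod 5)) = 1 ∨ Matrix.det ((g : GL (Fin 2) (ZMod 5)) : Matrix (Fin 2) (Fin 2) (ZMod 5)) = -1) → (∃ c ∈ G, Matrix.trace ((c : GL (Fin 2) (ZMod 5)) : Matrix (Fin 2) (Fin 2) (ZMod 5)) = 0 ∧ Matrix.det ((c : GL (Fin 2) (ZMod 5)) : Matrix (Fin 2) (Fin 2) (ZMod 5)) = -1) → (¬ ∃ v : Fin 2 → ZMod 5, v ≠ 0 ∧ ∀ g ∈ G, ∃ a : ZMod 5, ((g : GL (Fin 2) (ZMod 5)) : Matrix (Fin 2) (Fin 2) (ZMod 5)) *ᵥ v = a • v) → Submodule.span (ZMod 5) ((fun g : GL (Fin 2) (ZMod 5) => ((g : GL (Fin 2) (ZMod 5)) : Matrix (Fin 2) (Fin 2) (ZMod 5))) '' {g : GL (Fin 2) (ZMod 5) | g ∈ G ∧ Matrix.det ((g : GL (Fin 2) (ZMod 5)) : Matrix (Fin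 2) (Fin 2) (ZMod 5)) = 1}) ≠ ⊤ → ∃ x : GL (Fin 2) (ZMod 5), (∀ g ∈ G, x * g * x⁻¹ ∈ Subgroup.closure ({(⟨!![2, 0; 0, 3], !![3, 0; 0, 2], by decide, by decide⟩ : GL (Fin 2) (ZMod 5)), (⟨!![0, 1; 1, 0], !![0, 1; 1, 0], by decide, by decide⟩ : GL (Fin 2) (ZMod 5))} : Set (GL (Fin 2) (ZMod 5)))) ∨ (∀ g ∈ G, x * g * x⁻¹ ∈ Subgroup.closure ({(⟨!![3, 1; 3, 3], !![3, 4; 2, 3], by decide, by decide⟩ : GL (Fin 2) (ZMod 5)), (⟨!![1, 0; 0, 4], !![1, 0; 0, 4], by decide, by decide⟩ : GL (Fin 2) (ZMod 5))} : Set (GL (Fin 2) (ZMod 5))))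

-- `GroupCensusFive` holds: proved by `Summit.Langlands.Langlands.Theorems.GroupCensusFive.groupCensusFive_proof` (its module imports this route file, so no `_holds` link can be stated here).

-- earlier Assembly (stmt-Langlands-17594, replaced 2026-08-16T23:25:07Z -> stmt-Langlands-17641): retired by None — RefinedLocusModular → ReductionToRefinedLocus → BoxBorelFive → BoxQuartic → GroupCensusFive → ConjFraming → SectorComplement → _root_.Langlands
/-- item stmt-Langlands-17641 · assembly · rank 1 · closed · proved by Summit.Langlands.Langlands.Theorems.SqrtFiveQuarticCovers.assembly_proof (prover) · by planner
sources: Box2022, FreitasLeHungSiksek2015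
[assembly] RefinedLocusModular → ReductionToRefinedLocus → BoxBorelFive → BoxQuartic →
SectorComplement → Langlands (literally the type of `closes`). -/
@[route_item "route-Langlands-SqrtFiveQuarticCovers"]
def Assembly : Prop :=
  RefinedLocusModular → ReductionToRefinedLocus → BoxBorelFive → BoxQuartic → SectorComplement → _root_.Langlands

-- `Assembly` holds: proved by `Summit.Langlands.Langlands.Theorems.SqrtFiveQuarticCovers.assembly_proof` (its module imports this route file, so no `_holds` link can be stated here).

/-! D-0027 §2.1 — DECIDING THEOREM (planner-authored via `route open/edit --closes-file`; by planner-plan-novel-Langlands-Langlands-e266a39d-d-v2-g11-0 2026-08-16T23:24:40Z):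
its hypotheses are this route's items and its conclusion the sub-problem Statement (glue_lint), and it elaborates with this file. -/

@[closes "route-Langlands-SqrtFiveQuarticCovers"] theorem closes (h₂ : RefinedLocusModular) (h₃ : ReductionToRefinedLocus) (h₄ : BoxBorelFive)
    (hB : BoxQuartic) (hC : SectorComplement) : _root_.Langlands := by
  refine hC ?_
  intro K _ _ hK hdeg E hE
  by_cases h5 : ∃ r : K, r ^ 2 = 5
  · by_contra hne
    obtain ⟨h3s, h5s, h7s⟩ := h₃ K hK hdeg h5 E hE hne
    rcases h5s with hb | hh
    · exact hne (h₄ K hK hdeg h5 E hE h3s hb h7s)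
    · exact hne (h₂ K hK hdeg h5 E hE h3s hh h7s)
  · exact hB K hK hdeg h5 E hE

end Summit.Langlands.Langlands.Theses.SqrtFiveQuarticCovers
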